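import Mathlib
import Summits.NavierStokesRegularity.NavierStokesRegularity.Theorems.EulerZoomLiouvillePowerGaugeEulerLiouvilleSelfSimilarVorticityFarFieldSource
import HarnessLib

/-!
# Crux `EulerZoomLiouville.PowerGaugeEulerLiouville` (stmt-NavierStokesRegularity-19832), THE ONE STATEMENT `stub_selfSimilarC2Needle`:
# THE VELOCITY OF A `C²` COLLAPSE PROFILE IS SOURCED ALONG RAYS BY THE NONLINEARITY, AND THE BLOW-UP-TIME TRACE OF THE MEMBER IS ITS
# SCATTERING PROFILE

Helper file (theorems only; `--supports stmt-NavierStokesRegularity-19832`; def-free).  Hand leafhand-ns-eulerzoomliouville-10 g1, velocity twin of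
`…SelfSimilarCommutingVorticity` / `…SelfSimilarVorticityFarFieldSource`.

For a `C²` self-similar Euler profile `(U, P)` (CIV (3.3), centre `0`) write `N = (U·∇)U + ∇P` (`convect U U + gradient P`).  CIV (3.3) reads
`(1−γ)U + γ(y·∇)U = −N` (`VelocitySource.smul_fderiv_self_eq`): again an EULER-HOMOGENEITY equation (degree `−(1−γ)/γ = −(1+ρ)`, the critical
velocity decay) with source `−N`.  Hence (`0 < γ ≤ ½`, every class rate `γ = 1/(2+ρ)`, `ρ > 0`):

* `VelocitySource.rpow_smul_eq_integral` — `R^{1/γ−1} U(Rθ) = −γ⁻¹ ∫₀ᴿ r^{1/γ−2} N(rθ) dr` (`R ≥ 0`), and at `R = 1`: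
  `U(y) = −γ⁻¹∫₀¹ s^{1/γ−2} N(sy) ds` (`VelocitySource.eq_integral_source`);
* `VelocitySource.eq_zero_of_source_eq_zero` — if `N ≡ 0` (the profile is a steady Euler pair WITH ITS OWN PRESSURE) then `U ≡ 0` (every
  `0 < γ < 1`, homogeneity kill); `VelocitySource.norm_le_of_source_le` — `‖U(y)‖ ≤ (1−γ)⁻¹ sup_{[0,y]} ‖N‖`;
* `VelocitySource.tendsto_rpow_smul` — SCATTERING: if `r ↦ r^{1/γ−2} N(rθ)` is integrable on `(0,∞)` (true for the window tails, where
  `|N| ~ r^{−3−2ρ}`), then `R^{1/γ−1} U(Rθ) → A(θ) := −γ⁻¹∫₀^∞ r^{1/γ−2} N(rθ) dr`: the velocity is asymptotically homogeneous of the critical degree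
  `−(1+ρ)` along the ray with an explicitly sourced amplitude, and `A(θ) = 0` iff the ray's weighted nonlinearity budget balances
  (`VelocitySource.tendsto_zero_iff_integral_eq_zero`);
* `VelocitySource.tendsto_selfSimilarCollapse_nhdsLT_zero` — **BLOW-UP-TIME TRACE**: since `u(τ, x) = R^{1/γ−1} U(R x)` with `R = (−τ)^{−γ} → ∞`,
  the collapse `u = selfSimilarCollapse γ 0 U` has the pointwise trace `u(τ, x) → A(x)` as `τ → 0⁻` at every `x` whose ray budget converges — the
  final-time field of the collapse is the scattering transform of the profile's nonlinearity; member form `Loc.tendsto_nhdsLT_zero_of_selfSimilarC2`.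

WHAT THIS IS NOT: not a proof of the stub, the crux, or the route; nothing about Navier–Stokes. [folklore; ConstantinIgnatovaVicol2026Putative
§3.1.1 (3.2)–(3.3)]
-/

noncomputable section

-- flat `Theorems/<Route><Decl>…` files of one crux share the namespace of the crux (tree convention)
set_option linter.dupNamespace false

open MeasureTheory Set Filter Topology Metric Function intervalIntegral
open scoped RealInnerProductSpace NNReal ENNReal ContDiff

namespace Summit.NavierStokesRegularity.NavierStokesRegularity.Theorems.PowerGaugeEulerLiouville

open Literature.Analysis Literature.Analysis.FluidPDE

namespace VelocitySource

variable {γ : ℝ} {U : EuclideanSpace ℝ (Fin 3) → EuclideanSpace ℝ (Fin 3)} {P : EuclideanSpace ℝ (Fin 3) → ℝ}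

/-- **CIV (3.3) rearranged**: `γ DU(y)[y] = −(1−γ)U(y) − N(y)`, `N = (U·∇)U + ∇P`. [folklore; ConstantinIgnatovaVicol2026Putative §3.1.1 (3.3)] -/
theorem smul_fderiv_self_eq (hprof : IsSelfSimilarEulerProfile γ 0 U P) (y : EuclideanSpace ℝ (Fin 3)) :
    γ • fderiv ℝ U y y = -((1 - γ) • U y) - (convect U U y + gradient P y) := by
  have h := hprof.profile_eq y
  rw [sub_zero, map_add, map_smul] at h
  simp only [convect_apply]
  have : γ • fderiv ℝ U y y = -((1 - γ) • U y) - fderiv ℝ U y (U y) - gradient P y := by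
    rw [← sub_eq_zero]
    rw [← h]
    abel
  rw [this]; abel

/-- The source `N = (U·∇)U + ∇P` of a `C²` profile is continuous. [folklore] -/
theorem continuous_source (hprof : IsSelfSimilarEulerProfile γ 0 U P) :
    Continuous fun z => convect U U z + gradient P z := by
  have hU2 : ContDiff ℝ 2 U := hprof.contDiff_velocity
  have h1 : Continuous fun z => fderiv ℝ U z (U z) :=
    (hU2.continuous_fderiv (by norm_num)).clm_apply hU2.continuous
  have h2 : Continuous (gradient P) :=
    (InnerProductSpace.toDual ℝ (EuclideanSpace ℝ (Fin 3))).symm.continuous.comp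
      (hprof.contDiff_pressure.continuous_fderiv one_ne_zero)
  simpa [convect_apply, Pi.add_def] using h1.add h2

/-- **NO PROFILE IS A STEADY EULER PAIR WITH ITS OWN PRESSURE** (every `0 < γ < 1`): if `(U·∇)U + ∇P ≡ 0` then `U ≡ 0` — CIV (3.3) becomes the
Euler-homogeneity equation `U + (γ/(1−γ)) DU[y] = 0`. [folklore] -/
theorem eq_zero_of_source_eq_zero (hprof : IsSelfSimilarEulerProfile γ 0 U P) (hγ : 0 < γ) (hγ1 : γ < 1)
    (hN : ∀ y, convect U U y + gradient P y = 0) : U = 0 := by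
  have h1γ : 0 < 1 - γ := by linarith
  refine Beltrami.eq_zero_of_add_smul_fderiv_self hprof.differentiable_velocity (div_pos hγ h1γ) fun y => ?_
  have h := smul_fderiv_self_eq hprof y
  rw [hN y, sub_zero] at h
  -- `h : γ • DU y y = -((1-γ) • U y)`; divide by `1 - γ`
  have : (1 - γ) • (U y + (γ / (1 - γ)) • fderiv ℝ U y y) = 0 := by
    rw [smul_add, smul_smul, mul_div_cancel₀ _ h1γ.ne', h]
    abel
  rcases smul_eq_zero.1 this with h0 | h0
  · exact absurd h0 h1γ.ne'
  · exact h0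

/-- **SCALED RAY REPRESENTATION OF THE VELOCITY** (`0 < γ ≤ ½`): for every `θ` and `R ≥ 0`,
`R^{1/γ−1} • U(R • θ) = −γ⁻¹ ∫₀ᴿ r^{1/γ−2} • N(r • θ) dr`. [folklore] -/
theorem rpow_smul_eq_integral (hprof : IsSelfSimilarEulerProfile γ 0 U P) (hγ : 0 < γ) (hγ2 : γ ≤ 1 / 2)
    (θ : EuclideanSpace ℝ (Fin 3)) {R : ℝ} (hR : 0 ≤ R) :
    (R ^ (1 / γ - 1)) • U (R • θ) = -(γ⁻¹ • ∫ r in (0:ℝ)..R,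
      (r ^ (1 / γ - 2)) • (convect U U (r • θ) + gradient P (r • θ))) := by
  have hγ0 : γ ≠ 0 := hγ.ne'
  have hU2 : ContDiff ℝ 2 U := hprof.contDiff_velocity
  have hUd : Differentiable ℝ U := hprof.differentiable_velocity
  set N : EuclideanSpace ℝ (Fin 3) → EuclideanSpace ℝ (Fin 3) := fun z => convect U U z + gradient P z with hN
  have hNc : Continuous N := continuous_source hprof
  set q : ℝ := 1 / γ - 1 with hq
  have hqγ : q = γ⁻¹ - 1 := by rw [hq, one_div]
  have hq1 : 1 ≤ q := by
    have : 2 ≤ 1 / γ := by rw [le_div_iff₀ hγ]; linarith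
    linarith
  have hq0 : 0 < q := lt_of_lt_of_le one_pos hq1
  have hexp : 1 / γ - 2 = q - 1 := by rw [hq]; ring
  set g : ℝ → EuclideanSpace ℝ (Fin 3) := fun r => (r ^ q) • U (r • θ) with hg
  set g' : ℝ → EuclideanSpace ℝ (Fin 3) := fun r => -(γ⁻¹ • ((r ^ (q - 1)) • N (r • θ))) with hg'
  have hcont : ContinuousOn g (Icc 0 R) :=
    ((Real.continuous_rpow_const hq0.le).smul
      (hUd.continuous.comp (continuous_id.smul continuous_const))).continuousOn
  have hg'c : Continuous g' :=
    (((Real.continuous_rpow_const (by linarith)).smul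
      (hNc.comp (continuous_id.smul continuous_const))).const_smul γ⁻¹).neg
  have hint : IntervalIntegrable g' volume 0 R := hg'c.intervalIntegrable 0 R
  have hderiv : ∀ r ∈ Ioo (0:ℝ) R, HasDerivAt g (g' r) r := by
    intro r hr
    have hr0 : 0 < r := hr.1
    have h1 : HasDerivAt (fun r : ℝ => r ^ q) (q * r ^ (q - 1)) r := Real.hasDerivAt_rpow_const (Or.inl hr0.ne')
    have hline : HasDerivAt (fun r : ℝ => r • θ) ((1:ℝ) • θ) r := (hasDerivAt_id' r).smul_const θ
    have h2' := (hUd (r • θ)).hasFDerivAt.comp_hasDerivAt r hline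
    rw [one_smul] at h2'
    have h2 : HasDerivAt (fun r : ℝ => U (r • θ)) (fderiv ℝ U (r • θ) θ) r := h2'
    have h12 := h1.smul h2
    have hrθ : r • fderiv ℝ U (r • θ) θ = γ⁻¹ • (-((1 - γ) • U (r • θ)) - N (r • θ)) := by
      have hk := smul_fderiv_self_eq hprof (r • θ)
      rw [map_smul] at hk
      calc r • fderiv ℝ U (r • θ) θ = γ⁻¹ • (γ • r • fderiv ℝ U (r • θ) θ) := by
            rw [smul_smul γ⁻¹ γ, inv_mul_cancel₀ hγ0, one_smul]
        _ = γ⁻¹ • (-((1 - γ) • U (r • θ)) - N (r • θ)) := by rw [hk]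
    have hpow : r ^ q = r ^ (q - 1) * r := by
      rw [Real.rpow_sub_one hr0.ne' q, div_mul_cancel₀ _ hr0.ne']
    have hcoef : γ⁻¹ * (1 - γ) = q := by rw [hqγ]; field_simp
    have hrθ' : r • fderiv ℝ U (r • θ) θ = -(q • U (r • θ)) - γ⁻¹ • N (r • θ) := by
      rw [hrθ, smul_sub, smul_neg, smul_smul, hcoef]
    have hval : r ^ q • fderiv ℝ U (r • θ) θ + (q * r ^ (q - 1)) • U (r • θ) = g' r := by
      rw [hg', hpow, mul_smul, hrθ']
      module
    exact h12.congr_deriv hval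
  have hftc := integral_eq_sub_of_hasDerivAt_of_le hR hcont hderiv hint
  have hg0 : g 0 = 0 := by simp [hg, Real.zero_rpow hq0.ne']
  rw [hg0, sub_zero] at hftc
  show (R ^ q) • U (R • θ) = _
  rw [show (R ^ q) • U (R • θ) = g R from rfl, ← hftc, hg', hexp]
  simp only [intervalIntegral.integral_neg, intervalIntegral.integral_smul, hN]

/-- **RAY REPRESENTATION OF THE VELOCITY** (`0 < γ ≤ ½`): `U(y) = −γ⁻¹ ∫₀¹ s^{1/γ−2} • N(s • y) ds`. [folklore] -/
theorem eq_integral_source (hprof : IsSelfSimilarEulerProfile γ 0 U P) (hγ : 0 < γ) (hγ2 : γ ≤ 1 / 2)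
    (y : EuclideanSpace ℝ (Fin 3)) :
    U y = -(γ⁻¹ • ∫ s in (0:ℝ)..1, (s ^ (1 / γ - 2)) • (convect U U (s • y) + gradient P (s • y))) := by
  have h := rpow_smul_eq_integral hprof hγ hγ2 y zero_le_one
  rwa [Real.one_rpow, one_smul, one_smul] at h

/-- **POINTWISE DOMINATION OF THE VELOCITY BY THE NONLINEARITY ON `[0, y]`** (`0 < γ ≤ ½`): if `‖N(s y)‖ ≤ M` for `s ∈ [0,1]` then
`‖U(y)‖ ≤ (1−γ)⁻¹ M` (`γ⁻¹∫₀¹ s^{1/γ−2} ds = 1/(1−γ)`). [folklore] -/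
theorem norm_le_of_source_le (hprof : IsSelfSimilarEulerProfile γ 0 U P) (hγ : 0 < γ) (hγ2 : γ ≤ 1 / 2)
    {y : EuclideanSpace ℝ (Fin 3)} {M : ℝ}
    (hM : ∀ s ∈ Icc (0:ℝ) 1, ‖convect U U (s • y) + gradient P (s • y)‖ ≤ M) :
    ‖U y‖ ≤ (1 - γ)⁻¹ * M := by
  have hγ0 : γ ≠ 0 := hγ.ne'
  have h1γ : 0 < 1 - γ := by linarith
  set q : ℝ := 1 / γ - 1 with hq
  have hq1 : 1 ≤ q := by
    have : 2 ≤ 1 / γ := by rw [le_div_iff₀ hγ]; linarith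
    linarith
  have hq0 : 0 < q := lt_of_lt_of_le one_pos hq1
  have hexp : 1 / γ - 2 = q - 1 := by rw [hq]; ring
  rw [eq_integral_source hprof hγ hγ2 y, norm_neg, norm_smul, Real.norm_eq_abs, abs_of_pos (inv_pos.2 hγ), hexp]
  have hbound : ‖∫ s in (0:ℝ)..1, (s ^ (q - 1)) • (convect U U (s • y) + gradient P (s • y))‖ ≤
      ∫ s in (0:ℝ)..1, s ^ (q - 1) * M := by
    refine intervalIntegral.norm_integral_le_of_norm_le zero_le_one ?_ ?_
    · refine Filter.Eventually.of_forall fun s hs => ?_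
      have hs' : s ∈ Icc (0:ℝ) 1 := ⟨hs.1.le, hs.2⟩
      rw [norm_smul, Real.norm_eq_abs, abs_of_nonneg (Real.rpow_nonneg hs.1.le _)]
      exact mul_le_mul_of_nonneg_left (hM s hs') (Real.rpow_nonneg hs.1.le _)
    · exact ((Real.continuous_rpow_const (by linarith)).mul continuous_const).intervalIntegrable 0 1
  have hval : ∫ s in (0:ℝ)..1, s ^ (q - 1) * M = M / q := by
    rw [intervalIntegral.integral_mul_const, integral_rpow (Or.inl (by linarith)), sub_add_cancel, Real.one_rpow,
      Real.zero_rpow hq0.ne', sub_zero]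
    ring
  rw [hval] at hbound
  have hγq : γ * q = 1 - γ := by rw [hq]; field_simp
  calc γ⁻¹ * ‖∫ s in (0:ℝ)..1, (s ^ (q - 1)) • (convect U U (s • y) + gradient P (s • y))‖
      ≤ γ⁻¹ * (M / q) := mul_le_mul_of_nonneg_left hbound (inv_pos.2 hγ).le
    _ = (1 - γ)⁻¹ * M := by rw [← hγq]; field_simp

/-- **SCATTERING LIMIT FOR THE VELOCITY** (`0 < γ ≤ ½`): if `r ↦ r^{1/γ−2} • N(r • θ)` is integrable on `(0,∞)`, then
`R^{1/γ−1} • U(R • θ) → −γ⁻¹ • ∫₀^∞ r^{1/γ−2} • N(r • θ) dr` as `R → ∞` — the velocity is asymptotically homogeneous of the critical degree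
`−(1/γ − 1) = −(1+ρ)` along the ray, with amplitude the total weighted nonlinearity of the ray. [folklore] -/
theorem tendsto_rpow_smul (hprof : IsSelfSimilarEulerProfile γ 0 U P) (hγ : 0 < γ) (hγ2 : γ ≤ 1 / 2)
    (θ : EuclideanSpace ℝ (Fin 3))
    (hint : IntegrableOn (fun r : ℝ => (r ^ (1 / γ - 2)) • (convect U U (r • θ) + gradient P (r • θ))) (Ioi 0)) :
    Tendsto (fun R : ℝ => (R ^ (1 / γ - 1)) • U (R • θ)) atTop
      (𝓝 (-(γ⁻¹ • ∫ r in Ioi (0:ℝ), (r ^ (1 / γ - 2)) • (convect U U (r • θ) + gradient P (r • θ))))) := by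
  have hlim := (MeasureTheory.intervalIntegral_tendsto_integral_Ioi 0 hint tendsto_id).const_smul γ⁻¹ |>.neg
  refine hlim.congr' ?_
  filter_upwards [eventually_ge_atTop (0:ℝ)] with R hR
  simp only [id]
  exact (rpow_smul_eq_integral hprof hγ hγ2 θ hR).symm

/-- **Sub-critical velocity decay along a ray iff the ray's weighted nonlinearity budget balances** (`0 < γ ≤ ½`). [folklore] -/
theorem tendsto_zero_iff_integral_eq_zero (hprof : IsSelfSimilarEulerProfile γ 0 U P) (hγ : 0 < γ) (hγ2 : γ ≤ 1 / 2)
    (θ : EuclideanSpace ℝ (Fin 3))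
    (hint : IntegrableOn (fun r : ℝ => (r ^ (1 / γ - 2)) • (convect U U (r • θ) + gradient P (r • θ))) (Ioi 0)) :
    Tendsto (fun R : ℝ => (R ^ (1 / γ - 1)) • U (R • θ)) atTop (𝓝 0) ↔
      ∫ r in Ioi (0:ℝ), (r ^ (1 / γ - 2)) • (convect U U (r • θ) + gradient P (r • θ)) = 0 := by
  have hlim := tendsto_rpow_smul hprof hγ hγ2 θ hint
  constructor
  · intro h0
    have heq := tendsto_nhds_unique hlim h0
    rw [neg_eq_zero, smul_eq_zero] at heq
    rcases heq with h | h
    · exact absurd h (inv_ne_zero hγ.ne')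
    · exact h
  · intro h0
    rw [h0, smul_zero, neg_zero] at hlim
    exact hlim

/-- **BLOW-UP-TIME TRACE OF THE COLLAPSE** (`0 < γ ≤ ½`): the exact self-similar collapse `u = selfSimilarCollapse γ 0 U` satisfies
`u(τ, x) = R^{1/γ−1} U(R x)` with `R = (−τ)^{−γ} → ∞` as `τ → 0⁻`; hence at every `x` whose weighted nonlinearity is integrable along the ray,
`u(τ, x) → A(x) = −γ⁻¹ ∫₀^∞ r^{1/γ−2} N(r x) dr` as `τ → 0⁻`. [folklore; ConstantinIgnatovaVicol2026Putative §3.1 (3.2)] -/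
theorem tendsto_selfSimilarCollapse_nhdsLT_zero (hprof : IsSelfSimilarEulerProfile γ 0 U P) (hγ : 0 < γ) (hγ2 : γ ≤ 1 / 2)
    (x : EuclideanSpace ℝ (Fin 3))
    (hint : IntegrableOn (fun r : ℝ => (r ^ (1 / γ - 2)) • (convect U U (r • x) + gradient P (r • x))) (Ioi 0)) :
    Tendsto (fun τ : ℝ => selfSimilarCollapse γ 0 U τ x) (𝓝[<] 0)
      (𝓝 (-(γ⁻¹ • ∫ r in Ioi (0:ℝ), (r ^ (1 / γ - 2)) • (convect U U (r • x) + gradient P (r • x))))) := by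
  have hγ0 : γ ≠ 0 := hγ.ne'
  -- `τ ↦ −τ` maps `𝓝[<] 0` to `𝓝[>] 0`, and `s ↦ s^{−γ}` maps `𝓝[>] 0` to `atTop`
  have hneg : Tendsto (fun τ : ℝ => -τ) (𝓝[<] (0:ℝ)) (𝓝[>] (0:ℝ)) := by
    refine tendsto_nhdsWithin_iff.2 ⟨?_, ?_⟩
    · exact (continuous_neg.tendsto' (0:ℝ) 0 neg_zero).mono_left nhdsWithin_le_nhds
    · exact eventually_nhdsWithin_of_forall fun τ hτ => mem_Ioi.2 (neg_pos.2 (mem_Iio.1 hτ))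
  have hR : Tendsto (fun τ : ℝ => (-τ) ^ (-γ)) (𝓝[<] (0:ℝ)) atTop :=
    (tendsto_rpow_neg_nhdsGT_zero (neg_neg_of_pos hγ)).comp hneg
  have hlim := (tendsto_rpow_smul hprof hγ hγ2 x hint).comp hR
  refine hlim.congr' ?_
  filter_upwards [self_mem_nhdsWithin] with τ hτ
  have hτ' : 0 < -τ := neg_pos.2 hτ
  simp only [Function.comp_apply, selfSimilarCollapse_apply, zero_sub]
  congr 1
  rw [← Real.rpow_mul hτ'.le]
  congr 1
  field_simp
  ring

end VelocitySource

/-- **BLOW-UP-TIME TRACE OF AN EXACTLY SELF-SIMILAR MEMBER WITH `C²` PROFILE** (window `0 < ρ`): if `u(τ) = selfSimilarCollapse (1/(2+ρ)) 0 V τ`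
for `τ < 0` and `(V, P')` solves CIV (3.3) classically (e.g. the pressure of `Past.exists_isSelfSimilarEulerProfile`), then at every `x` whose
weighted nonlinearity `r ↦ r^{1/γ−2} ((V·∇)V + ∇P')(r x)` (`γ = 1/(2+ρ)`, so `1/γ − 2 = ρ`) is integrable on `(0,∞)`, the slices converge
pointwise as `τ → 0⁻`: `u(τ, x) → −γ⁻¹ ∫₀^∞ r^{1/γ−2} ((V·∇)V + ∇P')(r x) dr` — the blow-up-time field of the member is the scattering transform
of its profile's nonlinearity. [folklore] -/
theorem Loc.tendsto_nhdsLT_zero_of_selfSimilarC2 {ρ : ℝ} (hρ : 0 < ρ)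
    {u : ℝ → EuclideanSpace ℝ (Fin 3) → EuclideanSpace ℝ (Fin 3)}
    {V : EuclideanSpace ℝ (Fin 3) → EuclideanSpace ℝ (Fin 3)} {P' : EuclideanSpace ℝ (Fin 3) → ℝ}
    (hu : ∀ τ : ℝ, τ < 0 → u τ = selfSimilarCollapse (1 / (2 + ρ)) 0 V τ)
    (hprof : IsSelfSimilarEulerProfile (1 / (2 + ρ)) 0 V P') (x : EuclideanSpace ℝ (Fin 3))
    (hint : IntegrableOn (fun r : ℝ => (r ^ (1 / (1 / (2 + ρ)) - 2)) • (convect V V (r • x) + gradient P' (r • x))) (Ioi 0)) :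
    Tendsto (fun τ : ℝ => u τ x) (𝓝[<] 0)
      (𝓝 (-((1 / (2 + ρ))⁻¹ • ∫ r in Ioi (0:ℝ),
        (r ^ (1 / (1 / (2 + ρ)) - 2)) • (convect V V (r • x) + gradient P' (r • x))))) := by
  have h2ρ : (0 : ℝ) < 2 + ρ := by linarith
  have hγ : (0 : ℝ) < 1 / (2 + ρ) := one_div_pos.2 h2ρ
  have hγ2 : 1 / (2 + ρ) ≤ 1 / 2 := one_div_le_one_div_of_le two_pos (by linarith)
  have hlim := VelocitySource.tendsto_selfSimilarCollapse_nhdsLT_zero hprof hγ hγ2 x hint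
  refine hlim.congr' ?_
  filter_upwards [self_mem_nhdsWithin] with τ hτ
  rw [hu τ hτ]

end Summit.NavierStokesRegularity.NavierStokesRegularity.Theorems.PowerGaugeEulerLiouville

end
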